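import Mathlib
import HarnessLib.Audit
import Summits.PneNP.PneNP.Theorems.PstarFreshEraseGates
import Summits.PneNP.PneNP.Theorems.PstarSlotSwap

/-!
# Fresh gates are erasable, IV: the corollary without the slot convention (ROUND-24, memo §14.3; (G1) orientation-free)

FRONTIER range-avoidance ladder, rung F-N3, ROUND 24 (cell `pnp-ideate`, planner memo `r24/CORE-BOUND-NOTES.md` §14.3 (G1); restricted-model proof complexity —
nothing here bears on `P` versus `NP`).

`PstarFreshEraseGates.card_le_five_of_freshGates` asks that the touched chord variable sit in AND slot `2` of the gate.  Here the same corollary is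
proved for gates in EITHER orientation (`FreshGateS`), by passing to `PstarSlotSwap.swapAnd I g` for a slot-`3` gate inside the induction (all
terminal-core data are invariant, `PstarSlotSwap`):

* `FreshGateS` — `FreshGate` with the AND pair `{p, z}` in either order; `freshGate_of_freshGateS`, `freshGate_swapAnd_of_freshGateS`, `freshGateS_swapAnd`;
* `FreshGatesS` — the orientation-free hypothesis; `freshGatesS_symm`, `freshGatesS_erase`, `freshGatesS_swapAnd`;
* `card_le_five_of_freshGatesS` — **(G1′)**: Terminal + Assumption-A data + [every monomial touching a chord AND variable is a once-used fresh gate on it,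
  one per chord] ⟹ `#J₀ ≤ 5`.
-/

set_option linter.dupNamespace false -- `Summit.PneNP.PneNP.…`: summit = sub-problem name (D-0017 single-conjunct layout)

open Finset Literature.Computability.Complexity
open Summit.PneNP.PneNP.Theorems.PstarTyped (Typed)
open Summit.PneNP.PneNP.Theorems.PstarSALevel (varSet bdry BoundaryExpanding SimpleOverlap)
open Summit.PneNP.PneNP.Theorems.PstarGapOneAll (gval)
open Summit.PneNP.PneNP.Theorems.PstarCoreBound (XorClosed)
open Summit.PneNP.PneNP.Theorems.PstarChordRepair (IsChord)
open Summit.PneNP.PneNP.Theorems.PstarChordBridgeCotree (Peelable)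
open Summit.PneNP.PneNP.Theorems.PstarChordBridgeTools (privs mem_privs)
open Summit.PneNP.PneNP.Theorems.PstarCoreBoundTargets (Terminal card_le_five_of_terminal')
open Summit.PneNP.PneNP.Theorems.PstarFreshErase (FreshGate eraseGate)
open Summit.PneNP.PneNP.Theorems.PstarFreshEraseTerminal (terminal_eraseGate)
open Summit.PneNP.PneNP.Theorems.PstarFreshEraseGates (terminal_symm freshGate_mono)
open Summit.PneNP.PneNP.Theorems.PstarSlotSwap

namespace Summit.PneNP.PneNP.Theorems.PstarFreshEraseGatesSym

variable {n m : ℕ}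

/-! ## Orientation-free fresh gates -/

/-- **`FreshGate` with the AND pair `{p, z}` of `g` in either order.** -/
def FreshGateS (I : LocalMap 4 n m) (J₀ : Finset (Fin m)) (w₁ w₂ : Finset (Fin n) × Finset (Fin m) × Bool) (g : Fin m) (p z : Fin n) :
    Prop :=
  g ∈ w₁.2.1 ∧ g ∉ w₂.2.1 ∧ ((I.vars g 2 = p ∧ I.vars g 3 = z) ∨ (I.vars g 2 = z ∧ I.vars g 3 = p)) ∧ p ≠ z ∧ (∀ j ∈ J₀, z ∉ varSet I j) ∧
    z ∉ w₁.1 ∧ z ∉ w₂.1 ∧ (∀ g' ∈ w₁.2.1 ∪ w₂.2.1, g' ≠ g → I.vars g' 2 ≠ z ∧ I.vars g' 3 ≠ z)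

/-- In the slot-`2` orientation it is a `FreshGate`. -/
theorem freshGate_of_freshGateS {I : LocalMap 4 n m} {J₀ : Finset (Fin m)} {w₁ w₂ : Finset (Fin n) × Finset (Fin m) × Bool} {g : Fin m}
    {p z : Fin n} (h : FreshGateS I J₀ w₁ w₂ g p z) (h2 : I.vars g 2 = p) : FreshGate I J₀ w₁ w₂ g p z := by
  obtain ⟨hg₁, hg₂, hor, hpz, hJ, hC₁, hC₂, hoth⟩ := h
  have h3 : I.vars g 3 = z := by
    rcases hor with ⟨-, h3⟩ | ⟨h2', -⟩
    · exact h3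
    · exact absurd (h2.symm.trans h2') hpz
  exact ⟨hg₁, hg₂, h2, h3, hpz, hJ, hC₁, hC₂, hoth⟩

/-- In the slot-`3` orientation it is a `FreshGate` of the swapped instance. -/
theorem freshGate_swapAnd_of_freshGateS {I : LocalMap 4 n m} {J₀ : Finset (Fin m)} {w₁ w₂ : Finset (Fin n) × Finset (Fin m) × Bool} {g : Fin m}
    {p z : Fin n} (h : FreshGateS I J₀ w₁ w₂ g p z) (h3 : I.vars g 3 = p) : FreshGate (swapAnd I g) J₀ w₁ w₂ g p z := by
  obtain ⟨hg₁, hg₂, hor, hpz, hJ, hC₁, hC₂, hoth⟩ := h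
  have h2 : I.vars g 2 = z := by
    rcases hor with ⟨-, h3'⟩ | ⟨h2, -⟩
    · exact absurd (h3.symm.trans h3') hpz
    · exact h2
  refine ⟨hg₁, hg₂, (swapAnd_vars_two I g).1.trans h3, (swapAnd_vars_two I g).2.trans h2, hpz, fun j hj => ?_, hC₁, hC₂, fun g' hg' hne => ?_⟩
  · rw [varSet_swapAnd]; exact hJ j hj
  · rw [swapAnd_vars_of_ne I hne, swapAnd_vars_of_ne I hne]; exact hoth g' hg' hne

/-- `FreshGateS` is invariant under swapping the AND slots of any output. -/
theorem freshGateS_swapAnd {I : LocalMap 4 n m} {J₀ : Finset (Fin m)} {w₁ w₂ : Finset (Fin n) × Finset (Fin m) × Bool} {g : Fin m}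
    {p z : Fin n} (h : FreshGateS I J₀ w₁ w₂ g p z) (g₀ : Fin m) : FreshGateS (swapAnd I g₀) J₀ w₁ w₂ g p z := by
  obtain ⟨hg₁, hg₂, hor, hpz, hJ, hC₁, hC₂, hoth⟩ := h
  refine ⟨hg₁, hg₂, ?_, hpz, fun j hj => by rw [varSet_swapAnd]; exact hJ j hj, hC₁, hC₂, fun g' hg' hne => ?_⟩
  · by_cases hg : g = g₀
    · subst hg
      rw [(swapAnd_vars_two I g).1, (swapAnd_vars_two I g).2]
      rcases hor with ⟨h2, h3⟩ | ⟨h2, h3⟩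
      · exact Or.inr ⟨h3, h2⟩
      · exact Or.inl ⟨h3, h2⟩
    · rw [swapAnd_vars_of_ne I hg, swapAnd_vars_of_ne I hg]; exact hor
  · have h := hoth g' hg' hne
    by_cases hg : g' = g₀
    · subst hg; rw [(swapAnd_vars_two I g').1, (swapAnd_vars_two I g').2]; exact ⟨h.2, h.1⟩
    · rw [swapAnd_vars_of_ne I hg, swapAnd_vars_of_ne I hg]; exact h

/-- Freshness survives erasing other monomials. -/
theorem freshGateS_mono {I : LocalMap 4 n m} {J₀ : Finset (Fin m)} {w₁ w₂ w₁' w₂' : Finset (Fin n) × Finset (Fin m) × Bool} {g : Fin m}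
    {p z : Fin n} (h : FreshGateS I J₀ w₁ w₂ g p z) (h₁ : w₁'.1 = w₁.1) (h₂ : w₂'.1 = w₂.1) (hg : g ∈ w₁'.2.1)
    (hG₁ : w₁'.2.1 ⊆ w₁.2.1) (hG₂ : w₂'.2.1 ⊆ w₂.2.1) : FreshGateS I J₀ w₁' w₂' g p z := by
  obtain ⟨-, hg₂, hor, hpz, hJ, hC₁, hC₂, hoth⟩ := h
  refine ⟨hg, fun h => hg₂ (hG₂ h), hor, hpz, hJ, h₁ ▸ hC₁, h₂ ▸ hC₂, fun g' hg' hne => hoth g' ?_ hne⟩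
  rcases mem_union.1 hg' with h | h
  · exact mem_union_left _ (hG₁ h)
  · exact mem_union_right _ (hG₂ h)

/-- **The orientation-free hypothesis of (G1′)**: every monomial touching an AND variable of a chord `e ∈ J₀ ∖ F` is a fresh gate ON that variable (in
`w₁`, or in `w₂` with the roles swapped), and is the only monomial touching `e`. -/
def FreshGatesS (I : LocalMap 4 n m) (J₀ F : Finset (Fin m)) (w₁ w₂ : Finset (Fin n) × Finset (Fin m) × Bool) : Prop :=
  ∀ g ∈ w₁.2.1 ∪ w₂.2.1, ∀ e ∈ J₀ \ F, ∀ s : Fin 4, 2 ≤ s.val → (I.vars g s = I.vars e 2 ∨ I.vars g s = I.vars e 3) →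
    (∃ z, (g ∈ w₁.2.1 ∧ FreshGateS I J₀ w₁ w₂ g (I.vars g s) z) ∨ (g ∈ w₂.2.1 ∧ FreshGateS I J₀ w₂ w₁ g (I.vars g s) z)) ∧
    (∀ g' ∈ w₁.2.1 ∪ w₂.2.1, g' ≠ g → ∀ s' : Fin 4, 2 ≤ s'.val → I.vars g' s' ≠ I.vars e 2 ∧ I.vars g' s' ≠ I.vars e 3)

/-- The hypothesis is symmetric in the two constraints. -/
theorem freshGatesS_symm {I : LocalMap 4 n m} {J₀ F : Finset (Fin m)} {w₁ w₂ : Finset (Fin n) × Finset (Fin m) × Bool}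
    (h : FreshGatesS I J₀ F w₁ w₂) : FreshGatesS I J₀ F w₂ w₁ := by
  intro g hg e he s hs htouch
  rw [union_comm] at hg
  obtain ⟨⟨z, hz⟩, halone⟩ := h g hg e he s hs htouch
  exact ⟨⟨z, hz.symm⟩, fun g' hg' => halone g' (by rwa [union_comm] at hg')⟩

/-- The hypothesis survives erasing a monomial of `w₁`. -/
theorem freshGatesS_erase {I : LocalMap 4 n m} {J₀ F : Finset (Fin m)} {w₁ w₂ : Finset (Fin n) × Finset (Fin m) × Bool}
    (h : FreshGatesS I J₀ F w₁ w₂) (g₀ : Fin m) (hg₀ : g₀ ∉ w₂.2.1) : FreshGatesS I J₀ F (eraseGate w₁ g₀) w₂ := by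
  intro g hg e he s hs htouch
  have hsub : (eraseGate w₁ g₀).2.1 ∪ w₂.2.1 ⊆ w₁.2.1 ∪ w₂.2.1 := union_subset_union (erase_subset g₀ _) (Subset.refl _)
  have hgne : g ≠ g₀ := by
    rintro rfl
    rcases mem_union.1 hg with h' | h'
    · exact notMem_erase _ _ h'
    · exact hg₀ h'
  obtain ⟨⟨z, hz⟩, halone⟩ := h g (hsub hg) e he s hs htouch
  refine ⟨⟨z, ?_⟩, fun g' hg' => halone g' (hsub hg')⟩
  rcases hz with ⟨hg₁, hF⟩ | ⟨hg₂, hF⟩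
  · exact Or.inl ⟨mem_erase.2 ⟨hgne, hg₁⟩, freshGateS_mono hF rfl rfl (mem_erase.2 ⟨hgne, hg₁⟩) (erase_subset g₀ _) (Subset.refl _)⟩
  · exact Or.inr ⟨hg₂, freshGateS_mono hF rfl rfl hg₂ (Subset.refl _) (erase_subset g₀ _)⟩

/-- The hypothesis is invariant under swapping the AND slots of a MONOMIAL `g₀ ∉ J₀`. -/
theorem freshGatesS_swapAnd {I : LocalMap 4 n m} {J₀ F : Finset (Fin m)} {w₁ w₂ : Finset (Fin n) × Finset (Fin m) × Bool}
    (h : FreshGatesS I J₀ F w₁ w₂) {g₀ : Fin m} (hg₀ : g₀ ∉ J₀) : FreshGatesS (swapAnd I g₀) J₀ F w₁ w₂ := by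
  intro g hg e he s hs htouch
  have heg : e ≠ g₀ := fun h' => hg₀ (h' ▸ (mem_sdiff.1 he).1)
  rw [swapAnd_vars_of_ne I heg, swapAnd_vars_of_ne I heg] at htouch ⊢
  -- the touching slot of `g` in `I`
  set s' : Fin 4 := if g = g₀ then σ s else s with hs'def
  have hgs : (swapAnd I g₀).vars g s = I.vars g s' := by rw [swapAnd_vars]
  have hs' : 2 ≤ s'.val := by
    rw [hs'def]; split_ifs
    · exact (two_le_σ_iff s).2 hs
    · exact hs
  rw [hgs] at htouch ⊢
  obtain ⟨⟨z, hz⟩, halone⟩ := h g hg e he s' hs' htouch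
  refine ⟨⟨z, ?_⟩, fun g' hg' hne t ht => ?_⟩
  · rcases hz with ⟨hg₁, hF⟩ | ⟨hg₂, hF⟩
    · exact Or.inl ⟨hg₁, freshGateS_swapAnd hF g₀⟩
    · exact Or.inr ⟨hg₂, freshGateS_swapAnd hF g₀⟩
  · rw [swapAnd_vars]
    refine halone g' hg' hne _ ?_
    split_ifs
    · exact (two_le_σ_iff t).2 ht
    · exact ht

/-! ## (G1′) The orientation-free corollary -/

/-- **(G1′) induction form**, over all instances. -/
theorem card_le_five_of_freshGatesS_aux {r : ℕ} (y : Fin m → Bool) (J₀ F : Finset (Fin m)) (hF : F ⊆ J₀) :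
    ∀ (N : ℕ) (I : LocalMap 4 n m) (w₁ w₂ : Finset (Fin n) × Finset (Fin m) × Bool), I.IsPure xorAndPred → Typed I → SimpleOverlap I →
      BoundaryExpanding r I → Peelable I F → (∀ F', F ⊆ F' → F' ⊆ J₀ → Peelable I F' → F' = F) → (∀ e ∈ J₀ \ F, IsChord I J₀ e) →
      (∀ e ∈ J₀ \ F, I.vars e 2 ≠ I.vars e 3) → w₁.2.1.card + w₂.2.1.card ≤ N → Terminal I r y J₀ w₁ w₂ → FreshGatesS I J₀ F w₁ w₂ →
      J₀.card ≤ 5 := by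
  classical
  intro N
  induction N with
  | zero =>
    intro I w₁ w₂ hI hT hS hB hP hmax hchord _ hN ht _
    have h₁ : w₁.2.1 = ∅ := card_eq_zero.1 (by omega)
    have h₂ : w₂.2.1 = ∅ := card_eq_zero.1 (by omega)
    refine card_le_five_of_terminal' I hI hT hS hB y ht hF hP hmax hchord fun g hg => ?_
    rw [h₁, h₂, union_empty] at hg
    exact absurd hg (notMem_empty g)
  | succ N ih =>
    intro I w₁ w₂ hI hT hS hB hP hmax hchord hne hN ht hfr
    by_cases hviol : ∃ g ∈ w₁.2.1 ∪ w₂.2.1, ∃ e ∈ J₀ \ F, ∃ s : Fin 4, 2 ≤ s.val ∧ (I.vars g s = I.vars e 2 ∨ I.vars g s = I.vars e 3)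
    · obtain ⟨g, hg, e, he, s, hs, htouch⟩ := hviol
      -- w.l.o.g. the gate is in `w₁` (else swap the constraints)
      suffices key : ∀ (W₁ W₂ : Finset (Fin n) × Finset (Fin m) × Bool), W₁.2.1.card + W₂.2.1.card ≤ N + 1 → Terminal I r y J₀ W₁ W₂ →
          FreshGatesS I J₀ F W₁ W₂ → g ∈ W₁.2.1 ∪ W₂.2.1 → ∀ z, g ∈ W₁.2.1 → FreshGateS I J₀ W₁ W₂ g (I.vars g s) z →
          (∀ g' ∈ W₁.2.1 ∪ W₂.2.1, g' ≠ g → ∀ s' : Fin 4, 2 ≤ s'.val → I.vars g' s' ≠ I.vars e 2 ∧ I.vars g' s' ≠ I.vars e 3) → J₀.card ≤ 5 by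
        obtain ⟨⟨z, hz⟩, halone⟩ := hfr g hg e he s hs htouch
        rcases hz with ⟨hg₁, hFg⟩ | ⟨hg₂, hFg⟩
        · exact key w₁ w₂ hN ht hfr hg z hg₁ hFg halone
        · refine key w₂ w₁ (by omega) (terminal_symm ht) (freshGatesS_symm hfr) (by rw [union_comm]; exact hg) z hg₂ hFg fun g' hg' => ?_
          exact halone g' (by rwa [union_comm] at hg')
      intro W₁ W₂ hN' ht' hfr' _ z hg₁ hFg halone
      have hgJ : g ∉ J₀ := fun h => (disjoint_left.1 ht'.2.2.2.1) h hg₁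
      have hlt : (eraseGate W₁ g).2.1.card + W₂.2.1.card < W₁.2.1.card + W₂.2.1.card := by
        have := card_erase_lt_of_mem hg₁
        show (W₁.2.1.erase g).card + W₂.2.1.card < _
        omega
      -- orientation of the gate
      have hs23 : s = 2 ∨ s = 3 := by
        rcases s with ⟨_ | _ | _ | _ | q, hq⟩
        · exact absurd hs (by simp)
        · exact absurd hs (by simp)
        · exact Or.inl rfl
        · exact Or.inr rfl
        · omega
      rcases hs23 with rfl | rfl
      · -- slot 2: erase directly
        have hpe : I.vars e 2 = I.vars g 2 ∨ I.vars e 3 = I.vars g 2 := by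
          rcases htouch with h | h
          · exact Or.inl h.symm
          · exact Or.inr h.symm
        have ht'' := terminal_eraseGate I hI hT hS hB (freshGate_of_freshGateS hFg rfl) (mem_sdiff.1 he).1 hpe (hne e he) (hchord e he)
          halone ht'
        exact ih I _ _ hI hT hS hB hP hmax hchord hne (by omega) ht'' (freshGatesS_erase hfr' g hFg.2.1)
      · -- slot 3: swap the AND slots of `g`, then erase
        set I' := swapAnd I g with hI'
        have hFg' : FreshGate I' J₀ W₁ W₂ g (I'.vars g 2) z := by
          rw [hI', (swapAnd_vars_two I g).1]; exact freshGate_swapAnd_of_freshGateS hFg rfl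
        have heg : e ≠ g := fun h' => hgJ (h' ▸ (mem_sdiff.1 he).1)
        have hpe : I'.vars e 2 = I'.vars g 2 ∨ I'.vars e 3 = I'.vars g 2 := by
          rw [hI', swapAnd_vars_of_ne I heg, swapAnd_vars_of_ne I heg, (swapAnd_vars_two I g).1]
          rcases htouch with h | h
          · exact Or.inl h.symm
          · exact Or.inr h.symm
        have hne' : ∀ e ∈ J₀ \ F, I'.vars e 2 ≠ I'.vars e 3 := by
          intro e' he'
          have : e' ≠ g := fun h' => hgJ (h' ▸ (mem_sdiff.1 he').1)
          rw [hI', swapAnd_vars_of_ne I this, swapAnd_vars_of_ne I this]; exact hne e' he'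
        have hchord' : ∀ e ∈ J₀ \ F, IsChord I' J₀ e := fun e' he' => (isChord_swapAnd I g J₀ e').2 (hchord e' he')
        have halone' : ∀ g' ∈ W₁.2.1 ∪ W₂.2.1, g' ≠ g → ∀ s' : Fin 4, 2 ≤ s'.val → I'.vars g' s' ≠ I'.vars e 2 ∧ I'.vars g' s' ≠ I'.vars e 3 := by
          intro g' hg' hne'' s' hs'
          rw [hI', swapAnd_vars_of_ne I hne'', swapAnd_vars_of_ne I heg, swapAnd_vars_of_ne I heg]
          exact halone g' hg' hne'' s' hs'
        have ht'' := terminal_eraseGate I' (isPure_swapAnd hI g) (typed_swapAnd hT g) (simpleOverlap_swapAnd hS g)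
          (boundaryExpanding_swapAnd hB g) hFg' (mem_sdiff.1 he).1 hpe (hne' e he) (hchord' e he) halone'
          ((terminal_swapAnd hI g r y J₀ W₁ W₂).2 ht')
        exact ih I' _ _ (isPure_swapAnd hI g) (typed_swapAnd hT g) (simpleOverlap_swapAnd hS g) (boundaryExpanding_swapAnd hB g)
          ((peelable_swapAnd I g F).2 hP) (fun F' h1 h2 h3 => hmax F' h1 h2 ((peelable_swapAnd I g F').1 h3)) hchord' hne' (by omega) ht''
          (freshGatesS_erase (freshGatesS_swapAnd hfr' hgJ) g hFg.2.1)
    · refine card_le_five_of_terminal' I hI hT hS hB y ht hF hP hmax hchord fun g hg v hv => ?_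
      obtain ⟨e, he, hev⟩ := (mem_privs I).1 hv
      by_contra hc
      rw [not_and_or, not_not, not_not] at hc
      apply hviol
      refine ⟨g, hg, e, he, ?_⟩
      rcases hc with h | h
      · refine ⟨2, by decide, ?_⟩
        rcases hev with h' | h'
        · exact Or.inl (h.trans h'.symm)
        · exact Or.inr (h.trans h'.symm)
      · refine ⟨3, by decide, ?_⟩
        rcases hev with h' | h'
        · exact Or.inl (h.trans h'.symm)
        · exact Or.inr (h.trans h'.symm)

/-- **(G1′) COROLLARY OF FRESH ERASE, orientation-free.**  A terminal core with Assumption-A data in which every monomial touching an AND variable of a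
chord is a once-used fresh gate ON that variable (either AND slot; in `w₁` or in `w₂`) and each chord is touched by at most one monomial has at most
five outputs. -/
theorem card_le_five_of_freshGatesS {r : ℕ} (I : LocalMap 4 n m) (hI : I.IsPure xorAndPred) (hT : Typed I) (hS : SimpleOverlap I)
    (hB : BoundaryExpanding r I) {y : Fin m → Bool} {J₀ : Finset (Fin m)} {w₁ w₂ : Finset (Fin n) × Finset (Fin m) × Bool}
    (ht : Terminal I r y J₀ w₁ w₂) {F : Finset (Fin m)} (hF : F ⊆ J₀) (hP : Peelable I F)
    (hmax : ∀ F', F ⊆ F' → F' ⊆ J₀ → Peelable I F' → F' = F) (hchord : ∀ e ∈ J₀ \ F, IsChord I J₀ e)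
    (hne : ∀ e ∈ J₀ \ F, I.vars e 2 ≠ I.vars e 3) (hfresh : FreshGatesS I J₀ F w₁ w₂) : J₀.card ≤ 5 :=
  card_le_five_of_freshGatesS_aux y J₀ F hF _ I w₁ w₂ hI hT hS hB hP hmax hchord hne le_rfl ht hfresh

end Summit.PneNP.PneNP.Theorems.PstarFreshEraseGatesSym
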